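import Summits.QuantumFields.YangMills.Theorems.LogConcaveChartTransportDensity
import Summits.QuantumFields.YangMills.Theses.LogConcaveChart

/-!
# Route `LogConcaveChart` — support item `SandwichTransportMap` (stmt-QuantumFields-23667):
# **reduction to the isotropic frame `H₀ = 1`**

`SandwichTransportMap` (Caffarelli–Kolesnikov two-sided contraction, a theorem in print) asks, for a
positive definite `H₀` and a continuous `A` with second differences sandwiched in `(1 ± δ)·hᵀH₀h`,
for a `C¹` map `T` pushing `e^{−xᵀH₀x/2}dx/Z₀` to `e^{−A}dx/Z_A` (normalised Lebesgue integrals) with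
`T − id` `δ`-Lipschitz and `‖DT − I‖ ≤ δ` in the `H₀`-metric.  The theorem in print is stated for
the STANDARD Gaussian source.  This file proves, sorry-free, that the isotropic case implies the
item: with `P = H₀^{1/2}` (`exists_symm_sqrt`), put `Ã(y) := A(P⁻¹y)` — continuous, with second
differences sandwiched in `(1 ± δ)·|k|²` — take the isotropic map `T̃` for `Ã` and set
`T x := P⁻¹ T̃(P x)`.  Then `T ∈ C¹` (`contDiff_conj`), the two normalised-integral identities
match after the linear change of variables `x = P⁻¹y` (`integral_comp_mulVec`; the Jacobian
`|det P|⁻¹` cancels in each ratio), and the Euclidean pinching of `T̃` is exactly the `H₀`-metric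
pinching of `T` (`lipschitz_conj_pull`, `fderiv_conj_pull`).

* `Summit.QuantumFields.YangMills.Theorems.logConcaveChart_sandwichTransportMap_of_isotropic` —
  the reduction, with the isotropic statement written out as its hypothesis (no new definition).

HONEST SCOPE. A helper toward ONE cited support item: it does NOT prove `SandwichTransportMap`
(the isotropic Caffarelli–Kolesnikov theorem remains a theorem in print, not in Mathlib), nor
`QuadraticCovarianceComparison`, the `LogConcaveChart` thesis, rung R2a (`BalabanLadder.NT`) or any
summit statement; the Yang–Mills mass gap is NOT proved.  Filed by ideator seat ym-idea-8
(generation 8, lens «dual» = transport side).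
-/

namespace Summit.QuantumFields.YangMills.Cruxes.TransportCovarianceTransfer

open MeasureTheory Matrix

variable {n : ℕ}

/-- `vᵀ H₀ v = |P v|²` for `P` symmetric with `P² = H₀`. [folklore] -/
theorem quadForm_eq_mulVec_sq {P H₀ : Matrix (Fin n) (Fin n) ℝ} (hPs : P.IsSymm) (hPP : P * P = H₀)
    (v : Fin n → ℝ) : v ⬝ᵥ H₀ *ᵥ v = P *ᵥ v ⬝ᵥ P *ᵥ v := by
  rw [mulVec_dotProduct_mulVec hPs, hPP]

/-- `(P⁻¹ w)ᵀ H₀ (P⁻¹ w) = |w|²` for `P` symmetric invertible with `P² = H₀`. [folklore] -/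
theorem quadForm_inv_mulVec {P H₀ : Matrix (Fin n) (Fin n) ℝ} (hPs : P.IsSymm) (hP : P.det ≠ 0)
    (hPP : P * P = H₀) (w : Fin n → ℝ) : P⁻¹ *ᵥ w ⬝ᵥ H₀ *ᵥ (P⁻¹ *ᵥ w) = w ⬝ᵥ w := by
  rw [quadForm_eq_mulVec_sq hPs hPP, mulVec_inv_mulVec hP]

/-- Pull-back of the Euclidean Lipschitz pinching of `T̃ − id` to the `H₀`-metric pinching of
`T − id`, `T x = P⁻¹ T̃(P x)`. [folklore] -/
theorem lipschitz_conj_pull {δ : ℝ} {P H₀ : Matrix (Fin n) (Fin n) ℝ} (hPs : P.IsSymm)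
    (hP : P.det ≠ 0) (hPP : P * P = H₀) (S : (Fin n → ℝ) → (Fin n → ℝ))
    (hLip : ∀ y₁ y₂ : Fin n → ℝ,
      (S y₁ - S y₂ - (y₁ - y₂)) ⬝ᵥ (S y₁ - S y₂ - (y₁ - y₂)) ≤ δ ^ 2 * ((y₁ - y₂) ⬝ᵥ (y₁ - y₂)))
    (x₁ x₂ : Fin n → ℝ) :
    (P⁻¹ *ᵥ S (P *ᵥ x₁) - P⁻¹ *ᵥ S (P *ᵥ x₂) - (x₁ - x₂)) ⬝ᵥ
        H₀ *ᵥ (P⁻¹ *ᵥ S (P *ᵥ x₁) - P⁻¹ *ᵥ S (P *ᵥ x₂) - (x₁ - x₂)) ≤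
      δ ^ 2 * ((x₁ - x₂) ⬝ᵥ H₀ *ᵥ (x₁ - x₂)) := by
  have hv : P⁻¹ *ᵥ S (P *ᵥ x₁) - P⁻¹ *ᵥ S (P *ᵥ x₂) - (x₁ - x₂) =
      P⁻¹ *ᵥ (S (P *ᵥ x₁) - S (P *ᵥ x₂) - (P *ᵥ x₁ - P *ᵥ x₂)) := by
    rw [Matrix.mulVec_sub, Matrix.mulVec_sub, Matrix.mulVec_sub, inv_mulVec_mulVec hP,
      inv_mulVec_mulVec hP]
  rw [hv, quadForm_inv_mulVec hPs hP hPP, quadForm_eq_mulVec_sq hPs hPP, Matrix.mulVec_sub]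
  exact hLip (P *ᵥ x₁) (P *ᵥ x₂)

/-- Pull-back of the Euclidean derivative pinching `‖DT̃ − I‖ ≤ δ` to the `H₀`-metric pinching of
`T x = P⁻¹ T̃(P x)`. [folklore] -/
theorem fderiv_conj_pull {δ : ℝ} {P H₀ : Matrix (Fin n) (Fin n) ℝ} (hPs : P.IsSymm)
    (hP : P.det ≠ 0) (hPP : P * P = H₀) {S : (Fin n → ℝ) → (Fin n → ℝ)} (hS : ContDiff ℝ 1 S)
    (hD : ∀ y u : Fin n → ℝ,
      (fderiv ℝ S y u - u) ⬝ᵥ (fderiv ℝ S y u - u) ≤ δ ^ 2 * (u ⬝ᵥ u))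
    (x u : Fin n → ℝ) :
    (fderiv ℝ (fun x => P⁻¹ *ᵥ S (P *ᵥ x)) x u - u) ⬝ᵥ
        H₀ *ᵥ (fderiv ℝ (fun x => P⁻¹ *ᵥ S (P *ᵥ x)) x u - u) ≤ δ ^ 2 * (u ⬝ᵥ H₀ *ᵥ u) := by
  have hv : fderiv ℝ (fun x => P⁻¹ *ᵥ S (P *ᵥ x)) x u - u =
      P⁻¹ *ᵥ (fderiv ℝ S (P *ᵥ x) (P *ᵥ u) - P *ᵥ u) := by
    rw [fderiv_conj hS P⁻¹ P x u, Matrix.mulVec_sub, inv_mulVec_mulVec hP]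
  rw [hv, quadForm_inv_mulVec hPs hP hPP, quadForm_eq_mulVec_sq hPs hPP]
  exact hD (P *ᵥ x) (P *ᵥ u)

/-- Transfer of the second-difference sandwich to the frame `Ã(y) = A(P⁻¹ y)`:
the `H₀`-sandwich of `A` is the Euclidean sandwich of `Ã`. [folklore] -/
theorem sandwich_conj {δ : ℝ} {P H₀ : Matrix (Fin n) (Fin n) ℝ} (hPs : P.IsSymm) (hP : P.det ≠ 0)
    (hPP : P * P = H₀) {A : (Fin n → ℝ) → ℝ}
    (hsw : ∀ x h : Fin n → ℝ, (1 - δ) * (h ⬝ᵥ H₀ *ᵥ h) ≤ A (x + h) + A (x - h) - 2 * A x ∧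
      A (x + h) + A (x - h) - 2 * A x ≤ (1 + δ) * (h ⬝ᵥ H₀ *ᵥ h))
    (y k : Fin n → ℝ) :
    (1 - δ) * (k ⬝ᵥ k) ≤ A (P⁻¹ *ᵥ (y + k)) + A (P⁻¹ *ᵥ (y - k)) - 2 * A (P⁻¹ *ᵥ y) ∧
      A (P⁻¹ *ᵥ (y + k)) + A (P⁻¹ *ᵥ (y - k)) - 2 * A (P⁻¹ *ᵥ y) ≤ (1 + δ) * (k ⬝ᵥ k) := by
  have h := hsw (P⁻¹ *ᵥ y) (P⁻¹ *ᵥ k)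
  rw [quadForm_inv_mulVec hPs hP hPP] at h
  rwa [Matrix.mulVec_add, Matrix.mulVec_sub]

/-- Change of variables `x = P⁻¹ y` in a ratio of Lebesgue integrals: the Jacobian cancels.
[folklore] -/
theorem integral_div_comp_mulVec {P : Matrix (Fin n) (Fin n) ℝ} (hP : P.det ≠ 0)
    (h₁ h₂ : (Fin n → ℝ) → ℝ) :
    (∫ x, h₁ (P *ᵥ x)) / (∫ x, h₂ (P *ᵥ x)) = (∫ y, h₁ y) / ∫ y, h₂ y := by
  rw [integral_comp_mulVec hP h₁, integral_comp_mulVec hP h₂]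
  have hd : |P.det|⁻¹ ≠ 0 := inv_ne_zero (abs_ne_zero.mpr hP)
  rw [mul_div_mul_left _ _ hd]

end Summit.QuantumFields.YangMills.Cruxes.TransportCovarianceTransfer

namespace Summit.QuantumFields.YangMills.Theorems

open MeasureTheory Matrix Summit.QuantumFields.YangMills.Cruxes.TransportCovarianceTransfer in
/-- **Reduction of `SandwichTransportMap` to the isotropic frame** (helper toward item
stmt-QuantumFields-23667): if the two-sided Caffarelli–Kolesnikov transport statement holds for the
STANDARD Gaussian source (`H₀ = 1`, the hypothesis, written out), then it holds for every positive
definite `H₀` — conjugate by `P = H₀^{1/2}`.  [folklore: linear change of frame] -/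
theorem logConcaveChart_sandwichTransportMap_of_isotropic
    (hiso : ∀ δ : ℝ, 0 ≤ δ → δ ≤ 1 / 2 → ∀ (n : ℕ) (A : (Fin n → ℝ) → ℝ), Continuous A →
      (∀ x h : Fin n → ℝ, (1 - δ) * (h ⬝ᵥ h) ≤ A (x + h) + A (x - h) - 2 * A x ∧
        A (x + h) + A (x - h) - 2 * A x ≤ (1 + δ) * (h ⬝ᵥ h)) →
      ∃ T : (Fin n → ℝ) → (Fin n → ℝ), ContDiff ℝ 1 T ∧
        (∀ F : (Fin n → ℝ) → ℝ, Measurable F →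
          (∫ x, F (T x) * Real.exp (-(x ⬝ᵥ x) / 2)) / (∫ x : Fin n → ℝ, Real.exp (-(x ⬝ᵥ x) / 2)) =
            (∫ x, F x * Real.exp (-A x)) / ∫ x, Real.exp (-A x)) ∧
        (∀ x y : Fin n → ℝ, (T x - T y - (x - y)) ⬝ᵥ (T x - T y - (x - y)) ≤
          δ ^ 2 * ((x - y) ⬝ᵥ (x - y))) ∧
        (∀ x u : Fin n → ℝ, (fderiv ℝ T x u - u) ⬝ᵥ (fderiv ℝ T x u - u) ≤ δ ^ 2 * (u ⬝ᵥ u))) :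
    Summit.QuantumFields.YangMills.Theses.LogConcaveChart.SandwichTransportMap := by
  intro δ hδ0 hδ1 n H₀ A hH hA hsw
  obtain ⟨P, hPs, hP, hPP⟩ := exists_symm_sqrt hH
  -- the conjugated potential `Ã(y) = A(P⁻¹ y)`
  have hAc : Continuous fun y : Fin n → ℝ => A (P⁻¹ *ᵥ y) :=
    hA.comp (Matrix.mulVecLin P⁻¹).toContinuousLinearMap.continuous
  obtain ⟨S, hS1, hS2, hS3, hS4⟩ :=
    hiso δ hδ0 hδ1 n (fun y => A (P⁻¹ *ᵥ y)) hAc (sandwich_conj hPs hP hPP hsw)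
  refine ⟨fun x => P⁻¹ *ᵥ S (P *ᵥ x), contDiff_conj hS1 P⁻¹ P, ?_,
    lipschitz_conj_pull hPs hP hPP S hS3, fderiv_conj_pull hPs hP hPP hS1 hS4⟩
  intro F hF
  -- `F ∘ P⁻¹` is measurable; push it through the isotropic identity and change variables `y = P x`
  have hFm : Measurable fun y : Fin n → ℝ => F (P⁻¹ *ᵥ y) :=
    hF.comp (Matrix.mulVecLin P⁻¹).toContinuousLinearMap.continuous.measurable
  have hiso' := hS2 (fun y => F (P⁻¹ *ᵥ y)) hFm
  have h1 : (∫ x : Fin n → ℝ, F (P⁻¹ *ᵥ S (P *ᵥ x)) * Real.exp (-(x ⬝ᵥ H₀ *ᵥ x) / 2)) /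
      (∫ x : Fin n → ℝ, Real.exp (-(x ⬝ᵥ H₀ *ᵥ x) / 2)) =
      (∫ y : Fin n → ℝ, F (P⁻¹ *ᵥ S y) * Real.exp (-(y ⬝ᵥ y) / 2)) /
        ∫ y : Fin n → ℝ, Real.exp (-(y ⬝ᵥ y) / 2) := by
    have := integral_div_comp_mulVec hP (fun y => F (P⁻¹ *ᵥ S y) * Real.exp (-(y ⬝ᵥ y) / 2))
      (fun y => Real.exp (-(y ⬝ᵥ y) / 2))
    simpa only [← quadForm_eq_mulVec_sq hPs hPP] using this
  have h2 : (∫ x : Fin n → ℝ, F x * Real.exp (-A x)) / (∫ x : Fin n → ℝ, Real.exp (-A x)) =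
      (∫ y : Fin n → ℝ, F (P⁻¹ *ᵥ y) * Real.exp (-A (P⁻¹ *ᵥ y))) /
        ∫ y : Fin n → ℝ, Real.exp (-A (P⁻¹ *ᵥ y)) := by
    have := integral_div_comp_mulVec hP (fun y => F (P⁻¹ *ᵥ y) * Real.exp (-A (P⁻¹ *ᵥ y)))
      (fun y => Real.exp (-A (P⁻¹ *ᵥ y)))
    simpa only [inv_mulVec_mulVec hP] using this
  rw [h1, h2]
  exact hiso'

end Summit.QuantumFields.YangMills.Theorems

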